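import Summits.ResolutionOfSingularities.ResolutionOfSingularities.Theorems.HilbertSamuelEliminationSigmaMaxModificationsCorridor3WLadderIsoTailsArcLimitLayers
import Mathlib.RingTheory.MvPowerSeries.NoZeroDivisors
import HarnessLib

/-!
# [OURS · L1 W4.2 · D14 ROUTE G v2 «ARC LIMIT» · G2c, file 3] The limit ideal `J_∞ = (In_{P₀} J : t^∞)·S`

Sub-problem `ResolutionOfSingularities`, crux `SigmaMaxModifications` / conjunct `SigmaMaxModificationsCorridor3`
(route `HilbertSamuelElimination`, line `w_ladder`), idea chain L1 C5 «K1 FREE-RATIONAL TAILS», ROUTE G v2 (memo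
`L/res-L1-w42-lead-1/ROUTE-G-ARCLIMIT.md` 96c77a196e17bc23, §2–§3), over `…IsoTailsArcLimitLayers`.

For an ideal `J ⊆ S = K⟦t, y⟧` the `P₀`-INITIAL DATA in degree `j` is `layerSub J j = layer_j (J ∩ P₀^j)` (the degree-`j` part of
`In_{P₀}(J)`, realised inside `S` as `y`-homogeneous series of degree `j`), its `t`-SATURATION is `satLayer J j = {φ homogeneous of
degree j | ∃ k, t^k φ ∈ layerSub J j}`, and the LIMIT IDEAL is `limitIdeal J = S · ⋃_j satLayer J j` (memo: `J_∞ = Ĩ·S`).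
This file is the layer calculus of these three objects:

* `layer_mul_sum` — the convolution rule `layer j (a * x) = Σ_{i ≤ j} layer (j - i) a * layer i x`;
* `mul_mem_satLayer` (`Ĩ` is an ideal of `gr_{P₀} S`), **`layer_mem_satLayer_of_mem_limitIdeal`** (every layer of an element
  of `J_∞` is a saturated initial form), `limitIdeal_le_arcIdeal`;
* the three comparison facts consumed downstream: `mem_limitIdeal_sup_pow_of_mem` (`J ∩ P₀^j ⊆ J_∞ + P₀^{j+1}`),
  `exists_X_pow_mul_mem_of_mem_limitIdeal` (`h ∈ J_∞ ∩ P₀^j ⇒ t^k h ∈ (J ∩ P₀^j) + P₀^{j+1}`), and the TORSION-FREENESS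
  `mem_sup_limitIdeal_of_X_pow_mul_mem` (`f ∈ P₀^j`, `t^k f ∈ P₀^{j+1} + J_∞ ⇒ f ∈ P₀^{j+1} + J_∞`) = normal flatness of `S/J_∞`
  along `P₀` in substance.

Everything is OURS; no statement of the manuscript under adjudication and no published theorem is asserted.
[cite: HerrmannIkedaOrbanz1988, §30 (the device of quadratic sequences along 𝔭)]
-/

set_option linter.dupNamespace false -- mandated namespace of this single-conjunct summit
open MvPowerSeries
open Finsupp hiding some

noncomputable section

universe u

namespace Summit.ResolutionOfSingularities.ResolutionOfSingularities.Cruxes.SigmaMaxModifications.IdeasL1C5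

namespace ArcLimit

variable {d : ℕ} {K : Type u} [CommRing K]

/-! ### §1. The convolution rule for layers -/

/-- `t = X 0` is not zero (over a nontrivial coefficient ring). [folklore] -/
theorem X_zero_ne_zero [Nontrivial K] : (X 0 : MvPowerSeries (Fin (d + 1)) K) ≠ 0 := fun h => by
  have := congrArg (coeff (single (0 : Fin (d + 1)) 1)) h
  rw [coeff_X, if_pos rfl, map_zero] at this
  exact one_ne_zero this

/-- An element is congruent to the sum of its layers `≤ j` modulo `P₀^{j+1}`. [folklore] -/
theorem sub_sum_layer_mem_pow (x : MvPowerSeries (Fin (d + 1)) K) (j : ℕ) :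
    x - ∑ i ∈ Finset.range (j + 1), layer i x ∈ arcIdeal d K ^ (j + 1) := by
  rw [mem_arcIdeal_pow_iff]
  intro e he
  rw [map_sub, map_sum]
  simp_rw [coeff_layer]
  rw [Finset.sum_ite_eq (Finset.range (j + 1)) (yDeg e) (fun _ => coeff e x), if_pos (by rw [Finset.mem_range]; omega)]
  exact sub_self _

/-- Layers vanish on `P₀^{j+1}` in degrees `≤ j`. [folklore] -/
theorem layer_eq_zero_of_mem_pow_succ {j i : ℕ} (hij : i ≤ j) {r : MvPowerSeries (Fin (d + 1)) K}
    (hr : r ∈ arcIdeal d K ^ (j + 1)) : layer i r = 0 :=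
  layer_eq_zero_of_mem_pow hr (by omega)

/-- **Convolution rule**: `layer j (a * x) = Σ_{i ≤ j} layer (j - i) a * layer i x`. [folklore] -/
theorem layer_mul_sum (a x : MvPowerSeries (Fin (d + 1)) K) (j : ℕ) :
    layer j (a * x) = ∑ i ∈ Finset.range (j + 1), layer (j - i) a * layer i x := by
  have hx := sub_sum_layer_mem_pow x j
  have h1 : layer j (a * (x - ∑ i ∈ Finset.range (j + 1), layer i x)) = 0 :=
    layer_eq_zero_of_mem_pow_succ le_rfl (Ideal.mul_mem_left _ a hx)
  rw [mul_sub, map_sub, sub_eq_zero, Finset.mul_sum, map_sum] at h1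
  rw [h1]
  refine Finset.sum_congr rfl fun i hi => ?_
  rw [Finset.mem_range] at hi
  exact layer_mul_of_isWeightedHomogeneous (by omega) a (isWeightedHomogeneous_layer i x)

/-! ### §2. Initial layers, their saturation, the limit ideal -/

/-- The degree-`j` `P₀`-INITIAL DATA of `J`: the layers `layer_j g` of the elements `g ∈ J ∩ P₀^j` (a `K`-subspace of `S`).
[folklore] -/
def layerSub (J : Ideal (MvPowerSeries (Fin (d + 1)) K)) (j : ℕ) : Submodule K (MvPowerSeries (Fin (d + 1)) K) :=
  ((J ⊓ arcIdeal d K ^ j).restrictScalars K).map (layer j)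

/-- [OURS · L1 W4.2] `mem_layerSub_iff` — limit-ideal bookkeeping. [folklore] -/
theorem mem_layerSub_iff {J : Ideal (MvPowerSeries (Fin (d + 1)) K)} {j : ℕ} {φ : MvPowerSeries (Fin (d + 1)) K} :
    φ ∈ layerSub J j ↔ ∃ g, g ∈ J ∧ g ∈ arcIdeal d K ^ j ∧ layer j g = φ := by
  simp only [layerSub, Submodule.mem_map, Submodule.restrictScalars_mem, Ideal.mem_inf]
  exact ⟨fun ⟨g, ⟨h1, h2⟩, h3⟩ => ⟨g, h1, h2, h3⟩, fun ⟨g, h1, h2, h3⟩ => ⟨g, ⟨h1, h2⟩, h3⟩⟩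

/-- [OURS · L1 W4.2] `layer_mem_layerSub` — limit-ideal bookkeeping. [folklore] -/
theorem layer_mem_layerSub {J : Ideal (MvPowerSeries (Fin (d + 1)) K)} {j : ℕ} {g : MvPowerSeries (Fin (d + 1)) K}
    (hgJ : g ∈ J) (hgP : g ∈ arcIdeal d K ^ j) : layer j g ∈ layerSub J j :=
  mem_layerSub_iff.mpr ⟨g, hgJ, hgP, rfl⟩

/-- [OURS · L1 W4.2] `isWeightedHomogeneous_of_mem_layerSub` — limit-ideal bookkeeping. [folklore] -/
theorem isWeightedHomogeneous_of_mem_layerSub {J : Ideal (MvPowerSeries (Fin (d + 1)) K)} {j : ℕ}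
    {φ : MvPowerSeries (Fin (d + 1)) K} (hφ : φ ∈ layerSub J j) : IsWeightedHomogeneous (yW d) φ j := by
  obtain ⟨g, -, -, rfl⟩ := mem_layerSub_iff.mp hφ
  exact isWeightedHomogeneous_layer j g

/-- [OURS · L1 W4.2] `X_pow_mul_mem_layerSub` — limit-ideal bookkeeping. [folklore] -/
theorem X_pow_mul_mem_layerSub {J : Ideal (MvPowerSeries (Fin (d + 1)) K)} {j : ℕ} {φ : MvPowerSeries (Fin (d + 1)) K}
    (hφ : φ ∈ layerSub J j) (k : ℕ) : X 0 ^ k * φ ∈ layerSub J j := by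
  obtain ⟨g, hgJ, hgP, rfl⟩ := mem_layerSub_iff.mp hφ
  rw [← layer_X_zero_pow_mul]
  exact layer_mem_layerSub (Ideal.mul_mem_left _ _ hgJ) (Ideal.mul_mem_left _ _ hgP)

/-- A homogeneous factor of degree `i` moves initial data from degree `j` to degree `i + j`. [folklore] -/
theorem mul_mem_layerSub {J : Ideal (MvPowerSeries (Fin (d + 1)) K)} {i j : ℕ} {ψ φ : MvPowerSeries (Fin (d + 1)) K}
    (hψ : IsWeightedHomogeneous (yW d) ψ i) (hφ : φ ∈ layerSub J j) : ψ * φ ∈ layerSub J (i + j) := by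
  obtain ⟨g, hgJ, hgP, rfl⟩ := mem_layerSub_iff.mp hφ
  have h := layer_mul_of_isWeightedHomogeneous' (i := i) (j := i + j) (by omega) g hψ
  rw [Nat.add_sub_cancel_left] at h
  rw [← h]
  refine layer_mem_layerSub (Ideal.mul_mem_left _ _ hgJ) ?_
  rw [pow_add]
  exact Ideal.mul_mem_mul (mem_arcIdeal_pow_of_isWeightedHomogeneous hψ) hgP

/-- The `t`-SATURATED degree-`j` initial data: homogeneous `φ` of degree `j` with `t^k φ ∈ layerSub J j` for some `k`. [folklore] -/
def satLayer (J : Ideal (MvPowerSeries (Fin (d + 1)) K)) (j : ℕ) : Submodule K (MvPowerSeries (Fin (d + 1)) K) where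
  carrier := {φ | IsWeightedHomogeneous (yW d) φ j ∧ ∃ k : ℕ, X 0 ^ k * φ ∈ layerSub J j}
  zero_mem' := ⟨fun h => by simp at h, 0, by simp⟩
  add_mem' := by
    rintro a b ⟨ha, k, hk⟩ ⟨hb, l, hl⟩
    refine ⟨ha.add hb, k + l, ?_⟩
    rw [mul_add]
    refine Submodule.add_mem _ ?_ ?_
    · rw [pow_add, mul_comm (X 0 ^ k), mul_assoc]; exact X_pow_mul_mem_layerSub hk l
    · rw [pow_add, mul_assoc]; exact X_pow_mul_mem_layerSub hl k
  smul_mem' := by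
    rintro c a ⟨ha, k, hk⟩
    refine ⟨fun h => ha (by rw [map_smul, smul_eq_mul] at h; exact right_ne_zero_of_mul h), k, ?_⟩
    rw [mul_smul_comm]
    exact Submodule.smul_mem _ c hk

/-- [OURS · L1 W4.2] `mem_satLayer_iff` — limit-ideal bookkeeping. [folklore] -/
theorem mem_satLayer_iff {J : Ideal (MvPowerSeries (Fin (d + 1)) K)} {j : ℕ} {φ : MvPowerSeries (Fin (d + 1)) K} :
    φ ∈ satLayer J j ↔ IsWeightedHomogeneous (yW d) φ j ∧ ∃ k : ℕ, X 0 ^ k * φ ∈ layerSub J j := Iff.rfl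

/-- [OURS · L1 W4.2] `layerSub_le_satLayer` — limit-ideal bookkeeping. [folklore] -/
theorem layerSub_le_satLayer (J : Ideal (MvPowerSeries (Fin (d + 1)) K)) (j : ℕ) : layerSub J j ≤ satLayer J j :=
  fun _ hφ => ⟨isWeightedHomogeneous_of_mem_layerSub hφ, 0, by simpa using hφ⟩

/-- Saturation: `t^k φ ∈ satLayer ⇒ φ ∈ satLayer` for homogeneous `φ`. [folklore] -/
theorem mem_satLayer_of_X_pow_mul_mem {J : Ideal (MvPowerSeries (Fin (d + 1)) K)} {j k : ℕ}
    {φ : MvPowerSeries (Fin (d + 1)) K} (hφ : IsWeightedHomogeneous (yW d) φ j) (h : X 0 ^ k * φ ∈ satLayer J j) :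
    φ ∈ satLayer J j := by
  obtain ⟨-, l, hl⟩ := h
  exact ⟨hφ, l + k, by rw [pow_add, mul_assoc]; exact hl⟩

/-- `Ĩ` is an ideal of `gr_{P₀} S`: a homogeneous factor of degree `i` maps `satLayer J j` into `satLayer J (i + j)`. [folklore] -/
theorem mul_mem_satLayer {J : Ideal (MvPowerSeries (Fin (d + 1)) K)} {i j : ℕ} {ψ φ : MvPowerSeries (Fin (d + 1)) K}
    (hψ : IsWeightedHomogeneous (yW d) ψ i) (hφ : φ ∈ satLayer J j) : ψ * φ ∈ satLayer J (i + j) := by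
  obtain ⟨hφh, k, hk⟩ := hφ
  refine ⟨hψ.mul hφh, k, ?_⟩
  rw [mul_left_comm]
  exact mul_mem_layerSub hψ hk

/-- The LIMIT IDEAL `J_∞ = S · ⋃_j satLayer J j` (memo: `(In_{P₀} J : t^∞)·S`). [folklore] -/
def limitIdeal (J : Ideal (MvPowerSeries (Fin (d + 1)) K)) : Ideal (MvPowerSeries (Fin (d + 1)) K) :=
  Ideal.span (⋃ j : ℕ, (satLayer J j : Set (MvPowerSeries (Fin (d + 1)) K)))

/-- [OURS · L1 W4.2] `mem_limitIdeal_of_mem_satLayer` — limit-ideal bookkeeping. [folklore] -/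
theorem mem_limitIdeal_of_mem_satLayer {J : Ideal (MvPowerSeries (Fin (d + 1)) K)} {j : ℕ}
    {φ : MvPowerSeries (Fin (d + 1)) K} (hφ : φ ∈ satLayer J j) : φ ∈ limitIdeal J :=
  Ideal.subset_span (Set.mem_iUnion.mpr ⟨j, hφ⟩)

/-- [OURS · L1 W4.2] `layer_mem_limitIdeal` — limit-ideal bookkeeping. [folklore] -/
theorem layer_mem_limitIdeal {J : Ideal (MvPowerSeries (Fin (d + 1)) K)} {j : ℕ} {g : MvPowerSeries (Fin (d + 1)) K}
    (hgJ : g ∈ J) (hgP : g ∈ arcIdeal d K ^ j) : layer j g ∈ limitIdeal J :=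
  mem_limitIdeal_of_mem_satLayer (layerSub_le_satLayer J j (layer_mem_layerSub hgJ hgP))

/-- **Every layer of an element of `J_∞` is a saturated initial form.** [folklore] -/
theorem layer_mem_satLayer_of_mem_limitIdeal {J : Ideal (MvPowerSeries (Fin (d + 1)) K)}
    {h : MvPowerSeries (Fin (d + 1)) K} (hh : h ∈ limitIdeal J) (j : ℕ) : layer j h ∈ satLayer J j := by
  induction hh using Submodule.span_induction generalizing j with
  | mem x hx =>
    obtain ⟨i, hi⟩ := Set.mem_iUnion.mp hx
    by_cases hij : i = j
    · subst hij; rwa [layer_eq_self_of_isWeightedHomogeneous hi.1]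
    · rw [layer_eq_zero_of_isWeightedHomogeneous hi.1 hij]; exact Submodule.zero_mem _
  | zero => rw [map_zero]; exact Submodule.zero_mem _
  | add x y _ _ hx hy => rw [map_add]; exact Submodule.add_mem _ (hx j) (hy j)
  | smul a x _ hx =>
    rw [smul_eq_mul, layer_mul_sum]
    refine Submodule.sum_mem _ fun i hi => ?_
    rw [Finset.mem_range] at hi
    have := mul_mem_satLayer (isWeightedHomogeneous_layer (j - i) a) (hx i)
    rwa [Nat.sub_add_cancel (by omega)] at this

/-- If `J ⊆ P₀` then `J_∞ ⊆ P₀`. [folklore] -/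
theorem limitIdeal_le_arcIdeal [IsDomain K] {J : Ideal (MvPowerSeries (Fin (d + 1)) K)} (hJ : J ≤ arcIdeal d K) :
    limitIdeal J ≤ arcIdeal d K := by
  refine Ideal.span_le.mpr fun φ hφ => ?_
  obtain ⟨j, hφj, k, hk⟩ := Set.mem_iUnion.mp hφ
  rcases Nat.eq_zero_or_pos j with rfl | hj
  · -- degree 0: `layerSub J 0 = 0` because `layer 0` kills `P₀ ⊇ J`
    obtain ⟨g, hgJ, -, hg⟩ := mem_layerSub_iff.mp hk
    have h0 : layer 0 g = 0 := layer_eq_zero_of_mem_pow (j := 1) (by simpa using hJ hgJ) Nat.zero_lt_one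
    rw [h0] at hg
    have : φ = 0 := by
      rcases mul_eq_zero.mp hg.symm with h | h
      · exact absurd h (pow_ne_zero _ X_zero_ne_zero)
      · exact h
    rw [this]; exact Ideal.zero_mem _
  · have := mem_arcIdeal_pow_of_isWeightedHomogeneous hφj
    rw [← Nat.sub_add_cancel hj, pow_succ] at this
    exact Ideal.mul_le_left this

/-! ### §3. The three comparison facts -/

/-- `J ∩ P₀^j ⊆ J_∞ + P₀^{j+1}`. [folklore] -/
theorem mem_limitIdeal_sup_pow_of_mem {J : Ideal (MvPowerSeries (Fin (d + 1)) K)} {j : ℕ}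
    {g : MvPowerSeries (Fin (d + 1)) K} (hgJ : g ∈ J) (hgP : g ∈ arcIdeal d K ^ j) :
    g ∈ limitIdeal J ⊔ arcIdeal d K ^ (j + 1) := by
  have : g = layer j g + (g - layer j g) := by ring
  rw [this]
  exact Submodule.add_mem_sup (layer_mem_limitIdeal hgJ hgP) (sub_layer_mem_arcIdeal_pow_succ hgP)

/-- `h ∈ J_∞ ∩ P₀^j ⇒ t^k h ∈ (J ∩ P₀^j) + P₀^{j+1}` for some `k`. [folklore] -/
theorem exists_X_pow_mul_mem_of_mem_limitIdeal {J : Ideal (MvPowerSeries (Fin (d + 1)) K)} {j : ℕ}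
    {h : MvPowerSeries (Fin (d + 1)) K} (hh : h ∈ limitIdeal J) (hhP : h ∈ arcIdeal d K ^ j) :
    ∃ k : ℕ, X 0 ^ k * h ∈ (J ⊓ arcIdeal d K ^ j) ⊔ arcIdeal d K ^ (j + 1) := by
  obtain ⟨-, k, hk⟩ := layer_mem_satLayer_of_mem_limitIdeal hh j
  obtain ⟨g, hgJ, hgP, hg⟩ := mem_layerSub_iff.mp hk
  refine ⟨k, ?_⟩
  have : X 0 ^ k * h = g + (X 0 ^ k * (h - layer j h) - (g - layer j g)) := by rw [hg]; ring
  rw [this]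
  refine Submodule.add_mem_sup ⟨hgJ, hgP⟩ (Submodule.sub_mem _ (Ideal.mul_mem_left _ _ ?_) ?_)
  · exact sub_layer_mem_arcIdeal_pow_succ hhP
  · exact sub_layer_mem_arcIdeal_pow_succ hgP

/-- **Torsion-freeness of `gr_{P₀}(S/J_∞)`**: `f ∈ P₀^j`, `t^k f ∈ P₀^{j+1} + J_∞ ⇒ f ∈ P₀^{j+1} + J_∞`. [folklore] -/
theorem mem_sup_limitIdeal_of_X_pow_mul_mem {J : Ideal (MvPowerSeries (Fin (d + 1)) K)} {j k : ℕ}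
    {f : MvPowerSeries (Fin (d + 1)) K} (hf : f ∈ arcIdeal d K ^ j)
    (h : X 0 ^ k * f ∈ arcIdeal d K ^ (j + 1) ⊔ limitIdeal J) : f ∈ arcIdeal d K ^ (j + 1) ⊔ limitIdeal J := by
  obtain ⟨q, hq, r, hr, hqr⟩ := Submodule.mem_sup.mp h
  have hl : layer j (X 0 ^ k * f) = layer j r := by
    rw [← hqr, map_add, layer_eq_zero_of_mem_pow_succ le_rfl hq, zero_add]
  rw [layer_X_zero_pow_mul] at hl
  have hsat : layer j f ∈ satLayer J j :=
    mem_satLayer_of_X_pow_mul_mem (isWeightedHomogeneous_layer j f)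
      (by rw [hl]; exact layer_mem_satLayer_of_mem_limitIdeal hr j)
  have : f = (f - layer j f) + layer j f := by ring
  rw [this]
  exact Submodule.add_mem_sup (sub_layer_mem_arcIdeal_pow_succ hf) (mem_limitIdeal_of_mem_satLayer hsat)

end ArcLimit

end Summit.ResolutionOfSingularities.ResolutionOfSingularities.Cruxes.SigmaMaxModifications.IdeasL1C5

end
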